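import Summits.CriticalPhenomena.PercolationContinuityZ3.Theorems.Transplant.SkelPhiConcFaceStep
import Summits.CriticalPhenomena.PercolationContinuityZ3.Theorems.Transplant.SkelPhiWinStep
import Summits.CriticalPhenomena.PercolationContinuityZ3.Theorems.Transplant.SkelConcFaceData
import HarnessLib

/-!
# D″ node, (F) part 3 at φ-level (DPRIME-SCOPE §2 L6′, hp-8 column): the face step `cond_j` AS A WINDOW TARGET STEP — the packaging record
# `Skelφ.faceStepW G φ P w₀ Λ … : Skel.WinStepData V` (read through `Skelφ.stepLv/stepRg/tstep`) and every NON-KIT clause of the face obligation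
# `Skelφ.FaceOblAt` for it, over the two-unit cell geometry of record `Skelφ.cellGeomSG G φ P w₀ Λ` (p2-g7) — φ-level re-cut of `SkelConcFaceData`
# (hp-8 g24, p235381) with `PCells ↦ PCells2` and `P.Lv/Rg Φ ↦ Skelφ.stepLv/stepRg G φ P`

builds on p205010 (kernel theorem, internal audit signed; external expert review pending) — nothing in this file uses p205010.
Lane `prim-bschramm`, seat `prim-hp-8` (gen 30; L6′ (F) owner); helper file (`--supports stmt-CriticalPhenomena-4575`).  Hypotheses through
p3-g7's dictionary (DPRIME-SCOPE addendum K): `hlip : Skelφ.Lip G φ`, `hstep : Skelφ.Steps G φ` exactly where the part-2 facts / p2-g7's column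
device need them; `P : PCells2`, `Λ : ConcRadiiG` explicit data of the record.  TWO-UNIT SIGNATURE CHANGES (forced, not design): the planar
enclosure of the levels and the level-room lemma carry the transverse room `Rlev + 3 ≤ 3 r⊥` resp. `j' + 2 ≤ 3 r⊥` of
`PCells2.faceRow_enlarge_subset_farAS` (one unit: automatic from `k ≤ 10 s − 3 ≤ r/2`), the run-axis unit is `s∥ = P.s du.1`, and the planar
diameter in the rim excess is `50 rmax`.
The step: depth `Rπ := rE_{a'}(x, du)`, source box = the shifted face row `[faceLo, faceHi]` (planar level `5 r∥ + 10 s∥ (j+1) − 1`, transverse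
`2 r⊥`), planar region `Dpl := farAS x du j`, true target `T' = M_{a'}(x + du)` (the span), enlarged target `T = T' ∪ Rim`,
`Rim = {v ∈ Rg : d_G(w₀, v) > rM_{a'}(x+du) − L'}`, levels `j₀ = M + 1 … j₁ = Rlev`, source = window centre = `w₀`, support `Sfin`.
* §1 `faceStepW`, `faceStepW_Rg/_root/_T`, **`faceStepW_encl`** (`Rlev + 4 ≤ 10 s∥`, `Rlev + 3 ≤ 3 r⊥`), `faceStepW_T_subset_Rg` (`j ≤ K`),
  `faceStepW_T_sdiff_subset`, `Face_subset_faceStepW_X_zero`, `faceStepW_T_nonempty`, `M_nonempty_of_offset_le (hstep)`, `faceRow_hwide`,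
  `winLevel_faceRow_subset_Win`;
* §2 (history) `isSubbox_faceStepW (hlip) (hstep)`, `faceStepW_Rg_subset_Sfin`, `root_mem_faceStepW_Sfin`, `faceStepW_root_eq`,
  `root_not_mem_faceStepW_Rg`, `finSupp_faceStepW`, **`rim_excess_faceStepW (hlip) (hstep)`**.
Call sites port from `Skel.*` by `Φ ↦ hlip hstep` (the sublist used), `C ↦ P`, `P.Rg Φ ↦ stepRg G φ P`, `(P.Lv Φ).X ↦ (stepLv G φ P).X` (K2.2).
[cite: KozmaNitzan2024, §4 p. 27 ((30)), p. 30 (Step III), Lemma 10 (p. 17), Lemma 12 (p. 24)]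
-/

noncomputable section

open MeasureTheory
open scoped Classical

namespace Summit.CriticalPhenomena.PercolationContinuityZ3.Theorems.Transplant

namespace Skelφ

open Literature.Probability.Percolation Literature.Probability.LatticeModels SimpleGraph KNCells KNLevels GadgetSystem Contour
open Literature.Probability.Percolation.KozmaNitzan
open Literature.Probability.Percolation.KozmaNitzan.Cells (oth oth_ne sgOf sgOf_sign stepVec_apply_fst stepVec_apply_oth eq_oth_of_ne oth_oth)
open Literature.Barriers.CriticalPhenomena (graphBall graphBall_finite mem_graphBall_self graphBall_mono)
open BoxProdZ2 (ConcRadiiG)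
open Skel (winGraph WinStepData excess)

variable {V : Type} [DecidableEq V] (G : SimpleGraph V) [G.LocallyFinite] (φ : V → Site 2)

/-! ## §1 The window target step of the face `(x, du, j)` at anchor `a'`, two units -/

/-- **The face step of `cond_j` as a window target step** (two-unit cells): depth `rE_{a'}(x, du)`, source box = the shifted face row, planar
region `farAS x du j`, target `M_{a'}(x + du) ∪ Rim` (`Rim` = the region beyond depth `rM_{a'}(x + du) − L'`), levels `[M + 1, Rlev]`,
source `w₀` (φ-level form of `Skel.faceStepW`). [cite: KozmaNitzan2024, §4 p. 30 (Step III)] -/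
def faceStepW (P : PCells2) (w₀ : V) (Λ : ConcRadiiG) (a' : ℕ) (x : Site 2) (du : MDir) (j Rlev N M L' : ℕ) (Sfin : Finset V) :
    WinStepData V where
  Rπ := Λ.rE a' x du
  lo := P.faceLo x du j
  hi := P.faceHi x du j
  Dpl := P.farAS x du j
  T := (cellGeomSG G φ P w₀ Λ).M a' (x + stepVec du) ∪
    (Win G φ w₀ (P.farAS x du j) (Λ.rE a' x du)).filter fun v => v ∉ graphBall G w₀ (Λ.rM a' (x + stepVec du) - L')
  Rlev := Rlev
  N := N
  j₀ := M + 1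
  j₁ := Rlev
  root := w₀
  Sfin := Sfin

section Clauses

variable (P : PCells2) (w₀ : V) (Λ : ConcRadiiG) (a' : ℕ) (x : Site 2) (du : MDir) (j Rlev N M L' : ℕ) (Sfin : Finset V)

/-- The region of the face step is the window over the shrunk far rows. [folklore] -/
theorem faceStepW_Rg : stepRg G φ (faceStepW G φ P w₀ Λ a' x du j Rlev N M L' Sfin) = Win G φ w₀ (P.farAS x du j) (Λ.rE a' x du) :=
  rfl

/-- The source of the face step is the root. [folklore] -/
theorem faceStepW_root : (faceStepW G φ P w₀ Λ a' x du j Rlev N M L' Sfin).root = w₀ := rfl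

/-- The target of the face step. [folklore] -/
theorem faceStepW_T : (faceStepW G φ P w₀ Λ a' x du j Rlev N M L' Sfin).T = (cellGeomSG G φ P w₀ Λ).M a' (x + stepVec du) ∪
    (Win G φ w₀ (P.farAS x du j) (Λ.rE a' x du)).filter fun v => v ∉ graphBall G w₀ (Λ.rM a' (x + stepVec du) - L') := rfl

/-- **The planar enclosure of the levels**: `[lo − (Rlev+1), hi + (Rlev+1)] ⊆ farAS x du j` for `Rlev + 4 ≤ 10 s∥`, `Rlev + 3 ≤ 3 r⊥`,
`j + 1 ≤ K` (two units: the transverse room is an explicit hypothesis). [cite: KozmaNitzan2024, §4 Lemma 10 (p. 17: B⟨R+1⟩ ⊆ D), p. 30] -/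
theorem faceStepW_encl {j Rlev : ℕ} (hj : j + 1 ≤ P.K) (hRlev : Rlev + 4 ≤ 10 * P.s du.1) (hRlev' : Rlev + 3 ≤ 3 * P.r (oth du.1))
    (N M L' : ℕ) (Sfin : Finset V) :
    let Q := faceStepW G φ P w₀ Λ a' x du j Rlev N M L' Sfin
    Finset.Icc (Q.lo - ((Q.Rlev + 1 : ℕ) : Site 2)) (Q.hi + ((Q.Rlev + 1 : ℕ) : Site 2)) ⊆ Q.Dpl :=
  P.faceRow_enlarge_subset_farAS x du hj (show Rlev + 1 + 3 ≤ 10 * P.s du.1 by omega) (show Rlev + 1 + 2 ≤ 3 * P.r (oth du.1) by omega)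

variable {P Λ j} in
/-- **`T ⊆ Rg`** (`j ≤ K`, `rM ≤ rE`). [cite: KozmaNitzan2024, §4 Lemma 10 (p. 17: T ⊆ D)] -/
theorem faceStepW_T_subset_Rg (hW : WF2 P Λ) (hj : j ≤ P.K) :
    (faceStepW G φ P w₀ Λ a' x du j Rlev N M L' Sfin).T ⊆ stepRg G φ (faceStepW G φ P w₀ Λ a' x du j Rlev N M L' Sfin) :=
  Finset.union_subset (M_subset_Win_farAS P w₀ hW x du hj) (Finset.filter_subset _ _)

/-- `T ∖ M_{a'}(x + du)` lies in the rim. [folklore] -/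
theorem faceStepW_T_sdiff_subset :
    (faceStepW G φ P w₀ Λ a' x du j Rlev N M L' Sfin).T \ (cellGeomSG G φ P w₀ Λ).M a' (x + stepVec du) ⊆
      (Win G φ w₀ (P.farAS x du j) (Λ.rE a' x du)).filter fun v => v ∉ graphBall G w₀ (Λ.rM a' (x + stepVec du) - L') := by
  intro t ht
  obtain ⟨ht1, ht2⟩ := Finset.mem_sdiff.1 ht
  rcases Finset.mem_union.1 ht1 with h' | h'
  · exact absurd h' ht2
  · exact h'

variable {P Λ} in
/-- **`F^{j+1} ⊆ X_0`**: the face of record at level `j + 1` lies in the zeroth window level of the face step. [cite: KozmaNitzan2024, §4 p. 30] -/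
theorem Face_subset_faceStepW_X_zero (hW : WF2 P Λ) :
    (faceDataSG G φ P w₀ Λ).Face a' x du (j + 1) ⊆ (stepLv G φ (faceStepW G φ P w₀ Λ a' x du j Rlev N M L' Sfin)).X 0 := by
  rw [stepLv_X]
  have h0 : ∀ t : Site 2, t - ((0 : ℕ) : Site 2) = t := fun t => by simp
  have h0' : ∀ t : Site 2, t + ((0 : ℕ) : Site 2) = t := fun t => by simp
  rw [h0, h0']
  exact Face_subset_Win_faceRow P w₀ hW a' x du j

/-- The target is nonempty as soon as the true target `M_{a'}(x + du)` is. [folklore] -/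
theorem faceStepW_T_nonempty (hM : ((cellGeomSG G φ P w₀ Λ).M a' (x + stepVec du)).Nonempty) :
    (faceStepW G φ P w₀ Λ a' x du j Rlev N M L' Sfin).T.Nonempty :=
  hM.mono Finset.subset_union_left

variable {G φ Λ a'} in
/-- **Target nonemptiness from (ι) `Steps`**: `M_{a'}(v)` (a span) contains a vertex over `cen v` once `rM_{a'}(v)` exceeds the planar
ℓ¹-offset of `cen v` from `φ w₀` (p2-g7's column device `Skelφ.exists_mem_VWin_φ_eq`). [cite: KozmaNitzan2024, §4 p. 26 ((29))] -/
theorem M_nonempty_of_offset_le (hstep : Steps G φ) (v : Site 2)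
    (hR : (P.cen v 0 - φ w₀ 0).natAbs + (P.cen v 1 - φ w₀ 1).natAbs + 1 ≤ Λ.rM a' v) :
    ((cellGeomSG G φ P w₀ Λ).M a' v).Nonempty := by
  have hc : P.cen v ∈ P.M v := by
    rw [PCells2.M, P.mem_abox_iff]; intro i; have := P.one_le_r i; push_cast; constructor <;> omega
  have hc' : P.cen v + Pi.single (0 : Fin 2) ((1 : ℤˣ) : ℤ) ∈ P.M v := by
    rw [PCells2.M, P.mem_abox_iff]
    intro i
    have hr := P.one_le_r i
    push_cast
    by_cases hi : i = 0
    · subst hi; simp only [Pi.add_apply, Pi.single_eq_same]; constructor <;> omega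
    · simp only [Pi.add_apply, Pi.single_eq_of_ne hi, add_zero]; constructor <;> omega
  obtain ⟨y, hy, -⟩ := exists_mem_VWin_φ_eq hstep hc hc' hR
  exact ⟨y, hy⟩

/-! ### Planar room of the level boxes (for the kit clause) -/

omit [DecidableEq V] [G.LocallyFinite] in
/-- **The level boxes of the face step are wide from level `M + 1` on**: every side of `[faceLo − j', faceHi + j']` has length `≥ 2M + 2`
(the face row has extent `0` along the axis and `4 r⊥` across). [cite: KozmaNitzan2024, §4 p. 19 (windows)] -/
theorem faceRow_hwide (P : PCells2) (x : Site 2) (du : MDir) (j : ℕ) {M j' : ℕ} (hj' : M + 1 ≤ j') :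
    ∀ k, (P.faceLo x du j - (j' : Site 2)) k + 2 * M + 2 ≤ (P.faceHi x du j + (j' : Site 2)) k := by
  intro k
  have hj'' : (M : ℤ) + 1 ≤ j' := by exact_mod_cast hj'
  unfold PCells2.faceLo PCells2.faceHi
  simp only [Pi.sub_apply, Pi.add_apply, Pi.natCast_apply, sLo, sHi]
  by_cases hk : k = du.1
  · subst hk; simp only [if_true]; split_ifs <;> omega
  · simp only [hk, if_false]; have := P.one_le_r (oth du.1); omega

omit [DecidableEq V] in
/-- **The window levels `j' ≤ 10 s∥ − 3`, `j' + 2 ≤ 3 r⊥` of the face step lie in its region** (any depth). [cite: KozmaNitzan2024, §4 p. 30] -/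
theorem winLevel_faceRow_subset_Win {j : ℕ} (hj : j + 1 ≤ P.K) {j' : ℕ} (hj' : j' + 3 ≤ 10 * P.s du.1) (hj'' : j' + 2 ≤ 3 * P.r (oth du.1))
    (R : ℕ) : winLevel G φ w₀ R (P.faceLo x du j) (P.faceHi x du j) j' ⊆ Win G φ w₀ (P.farAS x du j) R :=
  Win_mono G φ (P.faceRow_enlarge_subset_farAS x du hj hj' hj'') le_rfl

end Clauses

/-! ## §2 The clauses that need the history: subbox, support, root, rim excess -/

section History

variable {G φ}
variable {P : PCells2} {w₀ : V} {Λ : ConcRadiiG} {S : KSchA V ℕ}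
variable (hΓ : S.Γ = cellGeomSG G φ P w₀ Λ) (hΛ : WFS2 P Λ)
variable {h : ProbeHistory V} {e : Site 2 × MDir} (hV : S.Valid₂ G h e) {a a' : ℕ} {du : MDir} (hdu : du ∈ S.onward G h (tgt e))
variable {j : ℕ} {o : Finset (Sym2 V)} (Rlev N M L' : ℕ)

include hΓ hΛ hV hdu

/-- **The region of the face step is a subbox of `Wt` in its window graph** (from `Lip`, `Steps`). [cite: KozmaNitzan2024, §4 p. 31] -/
theorem isSubbox_faceStepW (hlip : Lip G φ) (hstep : Steps G φ) :
    let Q := faceStepW G φ P w₀ Λ a' (tgt e) du j Rlev N M L' (S.Sx G h e a a' du)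
    KNLevels.IsSubbox (winGraph G Q.root Q.Rπ) (S.Wt G h e a a' du j o) S.p (stepRg G φ Q) :=
  isSubbox_Wt_faceWin hΓ hΛ hV hdu hlip hstep

omit hV hdu in
/-- `Rg ⊆ Sfin = Sx` (from `Lip`, `Steps`). [folklore] -/
theorem faceStepW_Rg_subset_Sfin (hlip : Lip G φ) (hstep : Steps G φ) :
    let Q := faceStepW G φ P w₀ Λ a' (tgt e) du j Rlev N M L' (S.Sx G h e a a' du)
    stepRg G φ Q ⊆ Q.Sfin :=
  Win_farAS_subset_Sx hΓ hΛ hlip hstep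

omit hΓ hΛ hdu in
/-- The root lies in the support. [folklore] -/
theorem root_mem_faceStepW_Sfin :
    S.Γ.root ∈ (faceStepW G φ P w₀ Λ a' (tgt e) du j Rlev N M L' (S.Sx G h e a a' du)).Sfin := by
  show S.Γ.root ∈ S.Sx G h e a a' du
  unfold KSchA.Sx
  exact Finset.mem_union_left _ (Finset.mem_union_left _ hV.root_mem)

omit hΛ hV hdu in
/-- The source of the face step is the scheme's root. [folklore] -/
theorem faceStepW_root_eq : (faceStepW G φ P w₀ Λ a' (tgt e) du j Rlev N M L' (S.Sx G h e a a' du)).root = S.Γ.root := by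
  rw [hΓ]; rfl

/-- The root lies off the region (from `Lip`, `Steps`). [folklore] -/
theorem root_not_mem_faceStepW_Rg (hlip : Lip G φ) (hstep : Steps G φ) :
    (faceStepW G φ P w₀ Λ a' (tgt e) du j Rlev N M L' (S.Sx G h e a a' du)).root ∉
      stepRg G φ (faceStepW G φ P w₀ Λ a' (tgt e) du j Rlev N M L' (S.Sx G h e a a' du)) := by
  rw [faceStepW_root_eq hΓ]
  exact root_not_mem_Win_farAS hΓ hΛ hV hdu hlip hstep

omit hΓ hΛ hV hdu in
/-- `Wt` is finitely supported on `Sfin = Sx`. [cite: KozmaNitzan2024, §4 p. 28 (Ω)] -/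
theorem finSupp_faceStepW :
    KNLevels.FinSupp (S.Wt G h e a a' du j o) (faceStepW G φ P w₀ Λ a' (tgt e) du j Rlev N M L' (S.Sx G h e a a' du)).Sfin :=
  KSchA.finSupp_Wt

/-- **The rim excess of the face step**: `P_{Wt}(⋃_{t ∈ T ∖ M_{a'}(x+du)} root ↔ t) ≤ η` from an excess radius `R₁ ≤ rM_{a'}(x+du) − L'` at the
running parameter (entrance depth `R₀ + 1`, `R₀ ≥ rQ_a(x), sup ρ_{a'}(x, du, ·)`; planar diameter `50 rmax`) (from `Lip`, `Steps`).
[cite: KozmaNitzan2024, §4 Lemma 12 (p. 24)] [cite: MartineauSevero2019, Cor. 2.2] -/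
theorem rim_excess_faceStepW [Countable V] (hlip : Lip G φ) (hstep : Steps G φ) {R₀ : ℕ} (hQ : Λ.rQ a (tgt e) ≤ R₀)
    (hρ : ∀ ℓ, Λ.ρ a' (tgt e) du ℓ ≤ R₀) {η : ℝ} {R₁ : ℕ}
    (hR₁ : ∀ R', R₁ ≤ R' → ∀ (Rw : ℕ) (D' A' : Finset V), (∀ d ∈ D', d ∈ graphBall G w₀ Rw) →
      (∀ d ∈ D', ∀ d' ∈ D', φ d - φ d' ∈ box 2 (50 * P.rmax)) → A' ⊆ D' → (∀ a ∈ A', a ∈ graphBall G w₀ (R₀ + 1)) →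
        (bondPercolation G S.p).real (excess G w₀ R' D' A') ≤ η)
    (hR : R₁ ≤ Λ.rM a' (tgt e + stepVec du) - L') :
    (prodBernoulli (S.Wt G h e a a' du j o)).real
      (⋃ t ∈ (faceStepW G φ P w₀ Λ a' (tgt e) du j Rlev N M L' (S.Sx G h e a a' du)).T \
          S.Γ.M a' (tgt e + stepVec du), openConn S.Γ.root t) ≤ η := by
  have hroot : S.Γ.root = w₀ := by rw [hΓ]; rfl
  have hsub : (faceStepW G φ P w₀ Λ a' (tgt e) du j Rlev N M L' (S.Sx G h e a a' du)).T \ S.Γ.M a' (tgt e + stepVec du) ⊆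
      (Win G φ w₀ (P.farAS (tgt e) du j) (Λ.rE a' (tgt e) du)).filter
        fun v => v ∉ graphBall G w₀ (Λ.rM a' (tgt e + stepVec du) - L') := by
    rw [hΓ]; exact faceStepW_T_sdiff_subset G φ P w₀ Λ a' (tgt e) du j Rlev N M L' _
  rw [hroot]
  refine le_trans (measureReal_mono (Set.iUnion₂_subset fun t ht => ?_) (measure_ne_top _ _))
    (rim_excess_face hΓ hΛ hV hdu (j := j) (o := o) hlip hstep hQ hρ hR₁ hR)
  exact Set.subset_biUnion_of_mem (u := fun t => openConn w₀ t) (hsub ht)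

end History

end Skelφ

end Summit.CriticalPhenomena.PercolationContinuityZ3.Theorems.Transplant

end
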